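import Literature.NumberTheory.LFunctions.Zhang2022.Section8DipoleSuperposition
import HarnessLib

/-!
# Zhang (2022) §8: the dipole rule for a `C²` piece — Taylor's formula at the far endpoint turns a profile vanishing at `Z`
# into a superposed weight (one ramp atom `−u′(Z)` at `Z`, density `u″`), so `Σ_{m≤P^Z} χ(m)m⁻¹u(z_m) = −L′(1,χ)u′(0)/log P + O(…)`

Topic `Literature/NumberTheory/LFunctions/Zhang2022` (Landau–Siegel audit tree; verdict-neutral). Y. Zhang, *Discrete mean
estimates and the Landau–Siegel zero*, arXiv:2211.02515v1 (2022) [Zhang2022LandauSiegel] — **an unrefereed manuscript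
under adjudication; nothing here asserts or denies its Theorems 1–2; no claim about Landau–Siegel zeros.** Cell
landau-siegel §D, crux K0 = stmt-Parity-20459, prover ls-knife-K0-p1 g0. Companion of `Section8DipoleSuperposition`
(the dipole rule for superposed weights, from Lemma 8.2 at `δ = 0`): here the CALLER's Taylor bookkeeping for the simplest
class — a piece `u` with `u, u′` continuous on `[0,Z]`, right derivatives `u′, u″` inside, `u″` integrable, `u(Z) = 0`:

* `taylor_ramp` — `u(z) = −u′(Z)·(Z − z)₊ + ∫₀^Z (y − z)₊u″(y)dy` on `[0,Z]` (Taylor at `Z` with integral remainder, proved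
  by the fundamental theorem of calculus for `Φ(y) = (y − z)u′(y) − u(y)`);
* `superposedWeight_C2` — i.e. `u = superposedWeight ![−u′(Z)] ![Z] Z u″` on `[0,Z]`, with jet `superposedJet = −u′(0)`
  (`superposedJet_C2`);
* `dipole_C2` — **the dipole rule for a `C²` piece** under (A) at a fixed modulus:
  `‖Σ_{m≤e^{Z𝓛⁹}} χ(m)m⁻¹u(log m/𝓛⁹) + (𝓛⁹)⁻¹L′(1,χ)u′(0)‖ ≤ (𝓛⁹)⁻¹[C₈₂(0)𝓛⁻⁶(‖u′(Z)‖ + ∫₀^Z‖u″‖) + τS(2𝓛^{2.2} + ‖L′‖)]`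
  (`τ = 𝓛^{1.1}/𝓛⁹ ≤ Z ≤ 1`, `‖u″‖ ≤ S` on `[0,τ]`) — LEMMA A of K1″a DISPLAY #2 («Σ_m χ(m)u(z_m)/m = −(L′/log P)u′(0⁺) + O(𝓛⁻¹⁵)»)
  for smooth one-piece profiles; the ψ-side inner sum of Prop 7.1's `S_j` is the instance `u ↦ e^{(β_j log P)z}u(z_t + z)`.

## References
* Y. Zhang, arXiv:2211.02515v1 (2022), §8 Lemma 8.2, pp. 16–17. [cite: Zhang2022LandauSiegel, §8 Lemma 8.2]
-/

noncomputable section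

open Complex Real Finset MeasureTheory intervalIntegral Set

namespace Literature.NumberTheory.LFunctions.Zhang2022.DipoleRule

variable {D : ℕ} [NeZero D] (χ : DirichletCharacter ℂ D)

/-! ### Taylor at the far endpoint, in ramp form -/

/-- **Taylor's formula at `Z` with integral remainder, ramp form:** if `u, u′` are continuous on `[0,Z]` with right
derivatives `u′`, `u″` on `(0,Z)`, `u″` integrable on `[0,Z]` and `u(Z) = 0`, then for `z ∈ [0,Z]`:
`u(z) = −u′(Z)(Z − z)₊ + ∫₀^Z (y − z)₊ u″(y) dy`. [cite: Zhang2022LandauSiegel, §8 Lemma 8.2] -/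
theorem taylor_ramp {u u' u'' : ℝ → ℂ} {Z : ℝ} (hu : ContinuousOn u (Icc 0 Z)) (hu' : ContinuousOn u' (Icc 0 Z))
    (hd : ∀ y ∈ Ioo 0 Z, HasDerivWithinAt u (u' y) (Ioi y) y)
    (hd' : ∀ y ∈ Ioo 0 Z, HasDerivWithinAt u' (u'' y) (Ioi y) y)
    (hint : IntervalIntegrable u'' volume 0 Z) (huZ : u Z = 0) {z : ℝ} (hz : z ∈ Icc 0 Z) :
    u z = -u' Z * (ramp Z z : ℂ) + ∫ y in (0:ℝ)..Z, (ramp y z : ℂ) * u'' y := by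
  have hz0 : 0 ≤ z := hz.1
  have hzZ : z ≤ Z := hz.2
  -- the integral over `[0,Z]` splits at `z`; below `z` the ramp vanishes
  have hsub1 : Set.uIcc (0:ℝ) z ⊆ Set.uIcc 0 Z := by
    rw [Set.uIcc_of_le hz0, Set.uIcc_of_le (hz0.trans hzZ)]; exact Set.Icc_subset_Icc_right hzZ
  have hsub2 : Set.uIcc z Z ⊆ Set.uIcc 0 Z := by
    rw [Set.uIcc_of_le hzZ, Set.uIcc_of_le (hz0.trans hzZ)]; exact Set.Icc_subset_Icc_left hz0
  have hri : IntervalIntegrable (fun y => (ramp y z : ℂ) * u'' y) volume 0 Z :=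
    hint.continuousOn_mul (Complex.continuous_ofReal.comp (continuous_ramp_left z)).continuousOn
  rw [← intervalIntegral.integral_add_adjacent_intervals (hri.mono_set hsub1) (hri.mono_set hsub2)]
  have hlow : ∫ y in (0:ℝ)..z, (ramp y z : ℂ) * u'' y = 0 := by
    have hcongr : ∫ y in (0:ℝ)..z, (ramp y z : ℂ) * u'' y = ∫ y in (0:ℝ)..z, (0 : ℂ) := by
      refine intervalIntegral.integral_congr fun y hy => ?_
      rw [Set.uIcc_of_le hz0] at hy
      have : ramp y z = 0 := by unfold ramp; exact max_eq_right (by linarith [hy.2])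
      simp [this]
    rw [hcongr, intervalIntegral.integral_zero]
  have hhigh : ∫ y in z..Z, (ramp y z : ℂ) * u'' y = ∫ y in z..Z, ((y - z : ℝ) : ℂ) * u'' y := by
    refine intervalIntegral.integral_congr fun y hy => ?_
    rw [Set.uIcc_of_le hzZ] at hy
    have : ramp y z = y - z := by unfold ramp; exact max_eq_left (by linarith [hy.1])
    simp [this]
  rw [hlow, zero_add, hhigh]
  -- FTC for `Φ(y) = (y − z)u′(y) − u(y)` on `[z, Z]`
  set Φ : ℝ → ℂ := fun y => ((y - z : ℝ) : ℂ) * u' y - u y with hΦ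
  have hΦc : ContinuousOn Φ (Icc z Z) := by
    have h1 : ContinuousOn (fun y : ℝ => ((y - z : ℝ) : ℂ)) (Icc z Z) :=
      (Complex.continuous_ofReal.comp (continuous_id.sub continuous_const)).continuousOn
    exact (h1.mul (hu'.mono (Set.Icc_subset_Icc_left hz0))).sub (hu.mono (Set.Icc_subset_Icc_left hz0))
  have hΦd : ∀ y ∈ Ioo z Z, HasDerivWithinAt Φ (((y - z : ℝ) : ℂ) * u'' y) (Ioi y) y := by
    intro y hy
    have hy' : y ∈ Ioo 0 Z := ⟨lt_of_le_of_lt hz0 hy.1, hy.2⟩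
    have h1 : HasDerivWithinAt (fun y : ℝ => ((y - z : ℝ) : ℂ)) 1 (Ioi y) y := by
      have := ((hasDerivAt_id y).sub_const z).ofReal_comp.hasDerivWithinAt (s := Ioi y)
      simpa using this
    have h2 : HasDerivWithinAt (fun y => ((y - z : ℝ) : ℂ) * u' y - u y)
        (1 * u' y + ((y - z : ℝ) : ℂ) * u'' y - u' y) (Ioi y) y := (h1.mul (hd' y hy')).sub (hd y hy')
    exact h2.congr_deriv (by ring)
  have hΦi : IntervalIntegrable (fun y => ((y - z : ℝ) : ℂ) * u'' y) volume z Z :=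
    (hint.mono_set hsub2).continuousOn_mul
      (Complex.continuous_ofReal.comp (continuous_id.sub continuous_const)).continuousOn
  have key := intervalIntegral.integral_eq_sub_of_hasDeriv_right_of_le hzZ hΦc hΦd hΦi
  rw [key]
  have hrZ : ramp Z z = Z - z := by unfold ramp; exact max_eq_left (by linarith)
  simp only [hΦ, huZ, sub_self, hrZ]
  push_cast
  ring

/-- **A `C²` piece vanishing at `Z` IS a superposed weight on `[0,Z]`:** one atom `−u′(Z)` at height `Z`, density `u″`.
[cite: Zhang2022LandauSiegel, §8 Lemma 8.2] -/
theorem superposedWeight_C2 {u u' u'' : ℝ → ℂ} {Z : ℝ} (hu : ContinuousOn u (Icc 0 Z)) (hu' : ContinuousOn u' (Icc 0 Z))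
    (hd : ∀ y ∈ Ioo 0 Z, HasDerivWithinAt u (u' y) (Ioi y) y)
    (hd' : ∀ y ∈ Ioo 0 Z, HasDerivWithinAt u' (u'' y) (Ioi y) y)
    (hint : IntervalIntegrable u'' volume 0 Z) (huZ : u Z = 0) {z : ℝ} (hz : z ∈ Icc 0 Z) :
    superposedWeight ![-u' Z] ![Z] Z u'' z = u z := by
  unfold superposedWeight
  rw [Fin.sum_univ_one, Matrix.cons_val_zero, Matrix.cons_val_zero, taylor_ramp hu hu' hd hd' hint huZ hz]

/-- … with jet `J = −u′(Z) + ∫₀^Z u″ = −u′(0)` (FTC for `u′`). [cite: Zhang2022LandauSiegel, §8 Lemma 8.2] -/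
theorem superposedJet_C2 {u' u'' : ℝ → ℂ} {Z : ℝ} (hZ : 0 ≤ Z) (hu' : ContinuousOn u' (Icc 0 Z))
    (hd' : ∀ y ∈ Ioo 0 Z, HasDerivWithinAt u' (u'' y) (Ioi y) y) (hint : IntervalIntegrable u'' volume 0 Z) :
    superposedJet ![-u' Z] Z u'' = -u' 0 := by
  unfold superposedJet
  rw [Fin.sum_univ_one, Matrix.cons_val_zero, intervalIntegral.integral_eq_sub_of_hasDeriv_right_of_le hZ hu' hd' hint]
  ring

/-! ### The dipole rule for a `C²` piece -/

/-- **THE DIPOLE RULE FOR A `C²` PIECE (fixed modulus, under (A)) — LEMMA A for smooth one-piece profiles.** `χ` primitive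
mod `D`, `𝓛 = log D ≥ 3`, `‖L(1,χ)‖ ≤ 𝓛⁻²⁰²²`, `τ = 𝓛^{1.1}/𝓛⁹ ≤ Z ≤ 1`; `u, u′` continuous on `[0,Z]` with right
derivatives `u′, u″` inside, `u″` integrable on `[0,Z]`, `‖u″‖ ≤ S` on `[0,τ]`, `u(Z) = 0`. Then
`‖Σ_{m≤e^{Z𝓛⁹}} χ(m)m⁻¹u(log m/𝓛⁹) + (𝓛⁹)⁻¹L′(1,χ)u′(0)‖ ≤ (𝓛⁹)⁻¹[C₈₂(0)𝓛⁻⁶(‖u′(Z)‖ + ∫₀^Z‖u″‖) + τS(2𝓛^{2.2} + ‖L′(1,χ)‖)]`.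
[cite: Zhang2022LandauSiegel, §8 Lemma 8.2] -/
theorem dipole_C2 (hprim : χ.IsPrimitive) (hL : 3 ≤ Real.log D) (hA : ‖χ.LFunction 1‖ ≤ 1 / Real.log D ^ 2022)
    {u u' u'' : ℝ → ℂ} {Z S : ℝ} (hZ1 : Z ≤ 1) (hτZ : Real.log D ^ (11 / 10 : ℝ) / Real.log D ^ 9 ≤ Z)
    (hu : ContinuousOn u (Icc 0 Z)) (hu' : ContinuousOn u' (Icc 0 Z))
    (hd : ∀ y ∈ Ioo 0 Z, HasDerivWithinAt u (u' y) (Ioi y) y)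
    (hd' : ∀ y ∈ Ioo 0 Z, HasDerivWithinAt u' (u'' y) (Ioi y) y)
    (hint : IntervalIntegrable u'' volume 0 Z) (huZ : u Z = 0)
    (hS : ∀ y ∈ Icc (0 : ℝ) (Real.log D ^ (11 / 10 : ℝ) / Real.log D ^ 9), ‖u'' y‖ ≤ S) :
    ‖(∑ m ∈ Finset.Ioc 0 ⌊Real.exp (Z * Real.log D ^ 9)⌋₊, χ (m : ZMod D) * (m : ℂ)⁻¹ * u (Real.log m / Real.log D ^ 9))
        + ((Real.log D ^ 9 : ℝ) : ℂ)⁻¹ * deriv χ.LFunction 1 * u' 0‖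
      ≤ (Real.log D ^ 9)⁻¹ *
        (Lemma82.C82 0 / Real.log D ^ 6 * (‖u' Z‖ + ∫ y in (0:ℝ)..Z, ‖u'' y‖)
          + Real.log D ^ (11 / 10 : ℝ) / Real.log D ^ 9 * S *
            (2 * Real.log D ^ (22 / 10 : ℝ) + ‖deriv χ.LFunction 1‖)) := by
  have hℓ0 : 0 < Real.log D := by linarith
  have hΛ0 : 0 < Real.log D ^ 9 := by positivity
  have hτ0 : 0 ≤ Real.log D ^ (11 / 10 : ℝ) / Real.log D ^ 9 := by positivity
  have hZ0 : 0 ≤ Z := hτ0.trans hτZ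
  -- the sum is the superposed sum (termwise on `z_m ∈ [0,Z]`)
  have hsum : ∑ m ∈ Finset.Ioc 0 ⌊Real.exp (Z * Real.log D ^ 9)⌋₊,
      χ (m : ZMod D) * (m : ℂ)⁻¹ * u (Real.log m / Real.log D ^ 9)
      = ∑ m ∈ Finset.Ioc 0 ⌊Real.exp (Z * Real.log D ^ 9)⌋₊,
          χ (m : ZMod D) * (m : ℂ)⁻¹ * superposedWeight ![-u' Z] ![Z] Z u'' (Real.log m / Real.log D ^ 9) := by
    refine Finset.sum_congr rfl fun m hm => ?_
    rw [Finset.mem_Ioc] at hm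
    have hm0 : (0 : ℝ) < m := by exact_mod_cast hm.1
    have hz : Real.log m / Real.log D ^ 9 ∈ Icc 0 Z := by
      refine ⟨div_nonneg (Real.log_nonneg (by exact_mod_cast hm.1)) hΛ0.le, ?_⟩
      rw [div_le_iff₀ hΛ0, ← Real.log_exp (Z * Real.log D ^ 9)]
      exact Real.log_le_log hm0 (le_trans (by exact_mod_cast hm.2) (Nat.floor_le (Real.exp_pos _).le))
    rw [superposedWeight_C2 hu hu' hd hd' hint huZ hz]
  have hjet : superposedJet ![-u' Z] Z u'' = -u' 0 := superposedJet_C2 hZ0 hu' hd' hint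
  have hmain := dipole_superposed χ hprim hL hA ![-u' Z] ![Z] (Z := Z) (S := S) (σ := u'') hZ1
    (fun i => by fin_cases i; exact ⟨hτZ, le_rfl⟩) hτZ hint hS
  rw [hjet] at hmain
  rw [hsum]
  have e : ((Real.log D ^ 9 : ℝ) : ℂ)⁻¹ * deriv χ.LFunction 1 * u' 0
      = -(((Real.log D ^ 9 : ℝ) : ℂ)⁻¹ * deriv χ.LFunction 1 * (-u' 0)) := by ring
  rw [e, ← sub_eq_add_neg]
  refine hmain.trans (le_of_eq ?_)
  simp [norm_neg]

end Literature.NumberTheory.LFunctions.Zhang2022.DipoleRule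

end
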